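import Literature.Geometry.Kaehler.ComplexTorusEllipticSelfProductAmpleCone
import Literature.Geometry.Kaehler.ComplexTorusEllipticCurveLefschetzGroup
import HarnessLib

/-!
# The ample cone of `E × E` with complex multiplication: four generators `F₁, F₂, Δ, Σ`
# (Bauer–Schulz §4.1: `E₁ = ℂ/(ℤ + iℤ)`; §4.2: `E₂ = ℂ/(ℤ + e^{πi/3}ℤ)`)

Layer `Literature/Geometry/Kaehler`, namespace `Literature.Geometry.Kaehler.ComplexTorus`; lane `lit-hodgefound`,
seat p07 (generation 48), programme «THE CONE OF CURVES OF AN ABELIAN SURFACE», file 72 of the seat lineage; sequel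
of file 71 (`ComplexTorusEllipticSelfProductAmpleCone`: the open positive cone `Q⁺` of an abelian surface —
`IsRiemannForm.pos_iff_intersectionForm_self_pos_and_pos`, `intersectionForm_pos_iff_of_self_pos` —, the Gram
matrix of `F₁, F₂, Δ`, Bauer–Schulz (2.0.1), and the intersection numbers `#(F₁ ∩ Σ_A) = 1`, `#(F₂ ∩ Σ_A) = |det A|`,
`#(Δ ∩ Σ_A) = |det(1 − A)|`, `= |α|²`, `|1 − α|²` on `E_τ`) and of file 70 (`ComplexTorusEllipticSelfProductConeOfCurves`),
with file 62 (`intersectionForm_nonneg_of_self_nonneg`), file 69 §1 (Hodge index), file 66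
(`Q(θ_C, θ_C') = #(C ∩ C')`), file 68 (`(C · η) > 0`) and the endomorphism ring of `E_τ`
(`ComplexTorusEllipticCurveEndomorphismRing` / `…Automorphisms`), all consumed BY NAME.  Theorems only (no definition,
no named fact, no instance, no notation; net debt `0`).

THE SOURCE, VERBATIM.  Th. Bauer, C. Schulz, *Seshadri constants on the self-product of an elliptic curve*, J. Algebra
320 (2008) [held text `paper:doi-10-1016-j-jalgebra-2008-06-024`], §4.1 [pp. 2994–2995 = p0014 L70–p0015 L27]:
"`E₁ = ℂ/ℤ + iℤ` … The Néron–Severi group of `E₁ × E₁` is of rank four, with generators `F₁, F₂, Δ, Σ`, where `F₁, F₂`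
are the fibers of the projections, `Δ` is the diagonal, and `Σ` is the graph of the automorphism `ι : E₁ → E₁,
[x] ↦ [ix]` … Note that `ι` has exactly two fixed-points: `[0]` and `[(1+i)/2]`. Therefore we have `Δ · Σ = 2`. As for
the remaining intersection numbers, we get `F₁² = F₂² = Δ² = Σ² = 0` and `F₁ · F₂ = F₁ · Δ = F₂ · Δ = F₁ · Σ = F₂ · Σ = 1`.
A line bundle `L = 𝒪_X(a₁F₁ + a₂F₂ + a₃Δ + a₄Σ)` is ample if and only if its self-intersection as well as its
intersection with the curves `F₁, F₂, Δ, Σ` are positive. (This follows in the same way as indicated after (2.0.1)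
in the rank three case.) So `L` is ample if and only if `a₂ + a₃ + a₄ > 0, a₁ + a₃ + a₄ > 0, a₁ + a₂ + 2a₄ > 0,
a₂ + a₂ + 2a₃ > 0` [sic; `= L · Σ = a₁ + a₂ + 2a₃`], `a₁a₂ + a₁a₃ + a₁a₄ + a₂a₃ + a₂a₄ + 2a₃a₄ > 0`."; §4.2
[p. 3001 = p0021 L20–L40]: "`E₂ = ℂ/ℤ + e^{πi/3}ℤ` … The automorphism `σ` has the point `[0]` as its only fixed
point. The fibers `F₁, F₂`, the diagonal `Δ`, and the graph `Σ` of `σ` generate the Néron–Severi group of `X`, and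
they have the intersection numbers `F₁² = F₂² = Δ² = Σ² = 0` and `F₁ · F₂ = F₁ · Δ = F₂ · Δ = F₁ · Σ = F₂ · Σ =
Δ · Σ = 1`. A line bundle `L = 𝒪_X(a₁F₁ + a₂F₂ + a₃Δ + a₄Σ)` is ample if and only if `a₂ + a₃ + a₄ = L · F₁ > 0,
a₁ + a₃ + a₄ = L · F₂ > 0, a₁ + a₂ + a₄ = L · Δ > 0, a₁ + a₂ + a₃ = L · Σ > 0, 2(a₁a₂ + a₁a₃ + a₁a₄ + a₂a₃ +
a₂a₄ + a₃a₄) = L² > 0`."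

THE MODEL is that of files 70–71 (`X = E × E` the Euclidean self-product `prodPeriodL2 Ψ Ψ` of a one-dimensional
torus `E = F/Ψ(ℤ^κ)`, `φ = prodHomeomorphL2 Ψ Ψ`, `F₁ = {t | (φ t).1 = 0}`, `F₂ = {t | (φ t).2 = 0}`,
`Δ = {t | (φ t).2 = (φ t).1}`, `Σ = Σ_A = {t | (φ t).2 = ρ(A)(φ t).1}` the graph of an endomorphism `ρ(A)` of `E`;
`Z₀, …, Z₃ : SubtorusFrame (prodPeriodL2 Ψ Ψ) (2·1)` sub-torus data presenting them through `0`, `θ₀, …, θ₃` the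
Néron–Severi classes of any of their translates, `[C]_e = ofRealForm (-θ_C)`; a real class is POSITIVE (Kähler;
AMPLE = `IsRiemannForm` when integral) when `θ(iv, v) > 0` for `v ≠ 0`; `E_τ = ℂ/(ℤτ + ℤ) = ComplexTorus (ellipticPeriod hτ)`,
`ℛ = ellipticEnd hτ ≅ End(E_τ)` via `ellipticEndEquiv`, `α = ρ_a(A)`).  The statements hold for EVERY endomorphism
`ρ(A)` (also `ρ(A) = n · 1`, whose graph is `Γ_n`): the four classes need not be independent.

* §1 `intersectionForm_pos_of_self_pos_of_self_nonneg` (any abelian surface: a class in the open positive cone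
  `Q⁺` pairs POSITIVELY with every non-zero class of the closed one — ample · curve `> 0`).
* §2 FOUR GENERATORS ON `E × E` (any `E`, any `A`): `exists_subtorusFrame_carrier_eq_setOf_graph` (`Σ_A` is an
  elliptic curve through `0`), `intersectionForm_graph_prodPeriodL2_self` (`Σ² = 0`, `F₁ · Σ = 1`, `F₂ · Σ = |det A|`,
  `Δ · Σ = |det(1 − A)|`), `intersectionForm_smul_add_graph_prodPeriodL2_self` (the five numbers `L · F₁, L · F₂, L · Δ,
  L · Σ, L²` of `L = xθ₀ + yθ₁ + zθ₂ + wθ₃`), **`pos_smul_add_graph_prodPeriodL2_self_iff`** (`L` positive iff all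
  five are positive), **`isRiemannForm_smul_add_graph_prodPeriodL2_self_iff`** (integral coefficients: ample iff …).
* §3 `E_τ × E_τ`: `exists_subtorusFrame_carrier_eq_setOf_graph_ellipticPeriod`, `natAbs_det_eq_normSq_and`
  (`|det A| = |α|²`, `|det(1 − A)| = |1 − α|²`), **`pos_smul_add_graph_ellipticPeriod_iff`** (the five inequalities
  with `d = |α|²`, `f = |1 − α|²`), **`pos_smul_add_graph_ellipticPeriod_iff_of_eq_I`** (§4.1 VERBATIM: `α = i`,
  `y + z + w > 0, x + z + w > 0, x + y + 2w > 0, x + y + 2z > 0, xy + xz + xw + yz + yw + 2zw > 0`),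
  **`pos_smul_add_graph_ellipticPeriod_iff_of_eq_exp`** (§4.2 VERBATIM: `α = e^{πi/3}`, all coefficients `1`).

## References

* [BauerSchulz2008] Th. Bauer, C. Schulz, *Seshadri constants on the self-product of an elliptic curve*, J. Algebra
  320 (2008) 2981–3005, §4.1 (pp. 2994–2995), §4.2 (p. 3001), and §2 (2.0.1) (p. 2985).
* [KollarMori1998] J. Kollár, S. Mori, *Birational Geometry of Algebraic Varieties*, CUP 1998, Ch. II §4 Cor. 1.21,
  Example 1.23 (2) (held copy pp. 20–21).
* [Hartshorne1977] R. Hartshorne, *Algebraic Geometry*, GTM 52, Springer 1977, Ch. IV Exercise 4.11 (a)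
  (`deg [α] = |α|²`).
* [Lange2023AbelianVarietiesComplex] H. Lange, *Abelian Varieties over the Complex Numbers*, Springer 2023, §6.2.2
  (p. 304: graphs), §1.1.2 Prop. 1.1.13, §2.2 Cor. 2.2.3.
-/

noncomputable section

set_option maxSynthPendingDepth 3

open scoped Manifold ComplexOrder NNReal InnerProductSpace Pointwise
open Complex Set Function Module Filter Topology WithLp

namespace Literature.Geometry.Kaehler

namespace ComplexTorus

universe u

/-! ### §1 The open positive cone pairs positively with the punctured closed one -/

section Pairing

variable {ι : Type*} [Fintype ι] [DecidableEq ι] {E : Type u} [NormedAddCommGroup E] [InnerProductSpace ℂ E]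
  [FiniteDimensional ℂ E] (Φ : (ι → ℝ) ≃L[ℝ] E) (e : Fin (2 * 2) ≃ ι)

/-- **`Q⁺ · (Q̅⁺ ∖ 0) > 0` on an abelian surface**: for real `(1,1)`-classes `α`, `θ` on a two-dimensional complex
torus with positive `(1,1)`-form `η`, if `Q(α, α) > 0`, `Q(α, η) > 0` (`α` in the open positive cone) and `θ ≠ 0`,
`Q(θ, θ) ≥ 0`, `Q(θ, η) ≥ 0` (`θ` in the closed one), then `Q(α, θ) > 0` — `≥ 0` by BHPVdV VIII (1.0) (file 62),
and `Q(α, θ) = 0` would put `θ ≠ 0` in `α^⊥`, which is negative definite (Hodge index).  In particular an ample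
class meets every curve positively. [cite: KollarMori1998, §II.4 Cor. 1.21 ("An effective curve has positive intersection with `H`") and Ex. 1.23 (2)]
[cite: BauerSchulz2008, §2 ("if `L` is ample then its intersections with the curves `F₁, F₂, Δ` … must be positive")] -/
theorem intersectionForm_pos_of_self_pos_of_self_nonneg {η α θ : E [⋀^Fin 2]→L[ℝ] ℝ}
    (h11 : ∀ u v : E, η ![I • u, I • v] = η ![u, v]) (hpos : ∀ v : E, v ≠ 0 → 0 < η ![I • v, v])
    (hα : ∀ u v : E, α ![I • u, I • v] = α ![u, v]) (hαα : 0 < intersectionForm (g := 2) Φ e α α)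
    (hαη : 0 < intersectionForm (g := 2) Φ e α η)
    (hθ : ∀ u v : E, θ ![I • u, I • v] = θ ![u, v]) (hθ0 : θ ≠ 0) (hθθ : 0 ≤ intersectionForm (g := 2) Φ e θ θ)
    (hθη : 0 ≤ intersectionForm (g := 2) Φ e θ η) :
    0 < intersectionForm (g := 2) Φ e α θ := by
  have hnn : 0 ≤ intersectionForm (g := 2) Φ e α θ :=
    intersectionForm_nonneg_of_self_nonneg Φ e h11 hpos hα hθ hαα.le hαη.le hθθ hθη
  refine lt_of_le_of_ne hnn fun h0 ↦ ?_
  have horth : intersectionForm (g := 2) Φ e θ α = 0 := by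
    rw [intersectionForm_comm Φ even_two e]
    exact h0.symm
  have := intersectionForm_self_neg_of_orthogonal_of_self_pos Φ e h11 hpos hα hαα hθ horth hθ0
  linarith

end Pairing

/-! ### §2 `E × E` with a fourth curve, the graph `Σ_A` of an endomorphism: Gram matrix and ample criterion -/

section FourGenerators

variable {κ : Type*} [Fintype κ] [DecidableEq κ] {F : Type u} [NormedAddCommGroup F] [InnerProductSpace ℂ F]
  [FiniteDimensional ℂ F] [MeasurableSpace F] [BorelSpace F] (Ψ : (κ → ℝ) ≃L[ℝ] F) {N : ℕ}

omit [FiniteDimensional ℂ F] [MeasurableSpace F] [BorelSpace F] in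
/-- **The graph `Σ_A = {(s, ρ(A)s)}` of an endomorphism of `E` is an elliptic curve through `0` of `E × E`** (the
Euclidean graph datum `SubtorusFrame.graphL2`; `ρ(A)` with `ℂ`-linear analytic representation `L`).
[cite: BauerSchulz2008, §4.1 ("`Σ` is the graph of the automorphism `ι`")] [cite: Lange2023AbelianVarietiesComplex, §6.2.2 (p. 304: the graph `Γ_f`)] -/
theorem exists_subtorusFrame_carrier_eq_setOf_graph (e₁ : Fin N ≃ κ) (he₁ : orientationSign Ψ e₁ = 1) {L : F →L[ℂ] F}
    {A : Matrix κ κ ℤ} (hA : ∀ x : κ → ℝ, Ψ ((A.map (Int.cast : ℤ → ℝ)).mulVec x) = L (Ψ x)) :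
    ∃ Z : SubtorusFrame (prodPeriodL2 Ψ Ψ) N,
      Z.carrier 0 = {t | (prodHomeomorphL2 Ψ Ψ t).2 = mapMatrix Ψ Ψ A (prodHomeomorphL2 Ψ Ψ t).1} :=
  ⟨SubtorusFrame.graphL2 Ψ Ψ e₁ he₁ L A hA, SubtorusFrame.carrier_graphL2_zero_eq Ψ Ψ e₁ he₁ hA⟩

variable (e : Fin (2 * 2) ≃ κ ⊕ κ) (he : orientationSign (prodPeriodL2 Ψ Ψ) e = 1) (A : Matrix κ κ ℤ)
  (Z₀ Z₁ Z₂ Z₃ : SubtorusFrame (prodPeriodL2 Ψ Ψ) (2 * 1))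
  (h₀ : Z₀.carrier 0 = {t | (prodHomeomorphL2 Ψ Ψ t).1 = 0})
  (h₁ : Z₁.carrier 0 = {t | (prodHomeomorphL2 Ψ Ψ t).2 = 0})
  (h₂ : Z₂.carrier 0 = {t | (prodHomeomorphL2 Ψ Ψ t).2 = (prodHomeomorphL2 Ψ Ψ t).1})
  (h₃ : Z₃.carrier 0 = {t | (prodHomeomorphL2 Ψ Ψ t).2 = mapMatrix Ψ Ψ A (prodHomeomorphL2 Ψ Ψ t).1})
  (a₀ a₁ a₂ a₃ : WithLp 2 (F × F)) {θ₀ θ₁ θ₂ θ₃ : WithLp 2 (F × F) [⋀^Fin 2]→L[ℝ] ℝ}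
  (hθ₀ : analyticCycleClass (prodPeriodL2 Ψ Ψ) e (show 2 * 1 + 2 * 1 = 2 * 2 from rfl) (Z₀.hasPureDim_carrier a₀) =
    ofRealForm (-θ₀))
  (hθ₁ : analyticCycleClass (prodPeriodL2 Ψ Ψ) e (show 2 * 1 + 2 * 1 = 2 * 2 from rfl) (Z₁.hasPureDim_carrier a₁) =
    ofRealForm (-θ₁))
  (hθ₂ : analyticCycleClass (prodPeriodL2 Ψ Ψ) e (show 2 * 1 + 2 * 1 = 2 * 2 from rfl) (Z₂.hasPureDim_carrier a₂) =
    ofRealForm (-θ₂))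
  (hθ₃ : analyticCycleClass (prodPeriodL2 Ψ Ψ) e (show 2 * 1 + 2 * 1 = 2 * 2 from rfl) (Z₃.hasPureDim_carrier a₃) =
    ofRealForm (-θ₃))

include he h₀ h₁ h₂ h₃ hθ₀ hθ₁ hθ₂ hθ₃ in
/-- **The Gram matrix of `F₁, F₂, Δ, Σ_A`**: `Σ² = 0`, `F₁ · Σ = 1`, `F₂ · Σ = # ker ρ(A) = |det A|`,
`Δ · Σ = # Fix ρ(A) = |det(1 − A)|` (file 71 §3; with file 71 §2: `F₁² = F₂² = Δ² = 0`, `F₁ · F₂ = F₁ · Δ = F₂ · Δ = 1`).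
[cite: BauerSchulz2008, §4.1 ("`F₁² = F₂² = Δ² = Σ² = 0`", "`F₁ · Σ = F₂ · Σ = 1`", "`Δ · Σ = 2`") and §4.2] -/
theorem intersectionForm_graph_prodPeriodL2_self :
    intersectionForm (g := 2) (prodPeriodL2 Ψ Ψ) e θ₃ θ₃ = 0 ∧ intersectionForm (g := 2) (prodPeriodL2 Ψ Ψ) e θ₀ θ₃ = 1 ∧
      intersectionForm (g := 2) (prodPeriodL2 Ψ Ψ) e θ₁ θ₃ = (A.det.natAbs : ℕ) ∧
        intersectionForm (g := 2) (prodPeriodL2 Ψ Ψ) e θ₂ θ₃ = ((1 - A).det.natAbs : ℕ) := by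
  refine ⟨Z₃.intersectionForm_self_eq_zero_of_analyticCycleClass_eq (prodPeriodL2 Ψ Ψ) e a₃ hθ₃, ?_, ?_, ?_⟩
  · rw [Z₀.intersectionForm_eq_natCard_of_analyticCycleClass_eq (prodPeriodL2 Ψ Ψ) e he Z₃ a₀ a₃ hθ₀ hθ₃, h₀, h₃,
      natCard_setOf_fst_eq_zero_inter_setOf_graph Ψ, Nat.cast_one]
  · rw [Z₁.intersectionForm_eq_natCard_of_analyticCycleClass_eq (prodPeriodL2 Ψ Ψ) e he Z₃ a₁ a₃ hθ₁ hθ₃, h₁, h₃,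
      natCard_setOf_snd_eq_zero_inter_setOf_graph Ψ]
  · rw [Z₂.intersectionForm_eq_natCard_of_analyticCycleClass_eq (prodPeriodL2 Ψ Ψ) e he Z₃ a₂ a₃ hθ₂ hθ₃, h₂, h₃,
      natCard_setOf_snd_eq_fst_inter_setOf_graph Ψ]

include he h₀ h₁ h₂ h₃ hθ₀ hθ₁ hθ₂ hθ₃ in
/-- **The intersection numbers of `L = xF₁ + yF₂ + zΔ + wΣ`**: `L · F₁ = y + z + w`, `L · F₂ = x + z + dw`,
`L · Δ = x + y + fw`, `L · Σ = x + dy + fz`, `L² = 2(xy + xz + xw + yz + dyw + fzw)` with `d = |det A| = F₂ · Σ`,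
`f = |det(1 − A)| = Δ · Σ`. [cite: BauerSchulz2008, §4.1 and §4.2 ("`a₂ + a₃ + a₄ = L · F₁ > 0, a₁ + a₃ + a₄ = L · F₂ > 0, a₁ + a₂ + a₄ = L · Δ > 0, a₁ + a₂ + a₃ = L · Σ > 0, 2(a₁a₂ + …) = L² > 0`")] -/
theorem intersectionForm_smul_add_graph_prodPeriodL2_self (x y z w : ℝ) :
    intersectionForm (g := 2) (prodPeriodL2 Ψ Ψ) e (x • θ₀ + y • θ₁ + z • θ₂ + w • θ₃) θ₀ = y + z + w ∧
    intersectionForm (g := 2) (prodPeriodL2 Ψ Ψ) e (x • θ₀ + y • θ₁ + z • θ₂ + w • θ₃) θ₁ =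
      x + z + (A.det.natAbs : ℕ) * w ∧
    intersectionForm (g := 2) (prodPeriodL2 Ψ Ψ) e (x • θ₀ + y • θ₁ + z • θ₂ + w • θ₃) θ₂ =
      x + y + ((1 - A).det.natAbs : ℕ) * w ∧
    intersectionForm (g := 2) (prodPeriodL2 Ψ Ψ) e (x • θ₀ + y • θ₁ + z • θ₂ + w • θ₃) θ₃ =
      x + (A.det.natAbs : ℕ) * y + ((1 - A).det.natAbs : ℕ) * z ∧
    intersectionForm (g := 2) (prodPeriodL2 Ψ Ψ) e (x • θ₀ + y • θ₁ + z • θ₂ + w • θ₃) (x • θ₀ + y • θ₁ + z • θ₂ + w • θ₃) =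
      2 * (x * y + x * z + x * w + y * z + (A.det.natAbs : ℕ) * (y * w) + ((1 - A).det.natAbs : ℕ) * (z * w)) := by
  obtain ⟨h00, h11', h22, h01, h02, h12⟩ :=
    intersectionForm_fibres_diagonal_prodPeriodL2_self Ψ e he Z₀ Z₁ Z₂ h₀ h₁ h₂ a₀ a₁ a₂ hθ₀ hθ₁ hθ₂
  obtain ⟨h33, h03, h13, h23⟩ :=
    intersectionForm_graph_prodPeriodL2_self Ψ e he A Z₀ Z₁ Z₂ Z₃ h₀ h₁ h₂ h₃ a₀ a₁ a₂ a₃ hθ₀ hθ₁ hθ₂ hθ₃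
  have h10 : intersectionForm (g := 2) (prodPeriodL2 Ψ Ψ) e θ₁ θ₀ = 1 := by rw [intersectionForm_comm _ even_two e, h01]
  have h20 : intersectionForm (g := 2) (prodPeriodL2 Ψ Ψ) e θ₂ θ₀ = 1 := by rw [intersectionForm_comm _ even_two e, h02]
  have h21 : intersectionForm (g := 2) (prodPeriodL2 Ψ Ψ) e θ₂ θ₁ = 1 := by rw [intersectionForm_comm _ even_two e, h12]
  have h30 : intersectionForm (g := 2) (prodPeriodL2 Ψ Ψ) e θ₃ θ₀ = 1 := by rw [intersectionForm_comm _ even_two e, h03]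
  have h31 : intersectionForm (g := 2) (prodPeriodL2 Ψ Ψ) e θ₃ θ₁ = (A.det.natAbs : ℕ) := by
    rw [intersectionForm_comm _ even_two e, h13]
  have h32 : intersectionForm (g := 2) (prodPeriodL2 Ψ Ψ) e θ₃ θ₂ = ((1 - A).det.natAbs : ℕ) := by
    rw [intersectionForm_comm _ even_two e, h23]
  simp only [map_add, map_smul, LinearMap.add_apply, LinearMap.smul_apply, smul_eq_mul, h00, h11', h22, h33, h01, h02,
    h03, h12, h13, h23, h10, h20, h21, h30, h31, h32]
  refine ⟨by ring, by ring, by ring, by ring, by ring⟩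

include he h₀ h₁ h₂ h₃ hθ₀ hθ₁ hθ₂ hθ₃ in
/-- **THE AMPLE CRITERION WITH FOUR GENERATORS (Bauer–Schulz §4.1/§4.2).**  On the Euclidean self-product `E × E` of
an elliptic curve (`dim_ℂ F = 1`), let `θ₀, θ₁, θ₂, θ₃` be the Néron–Severi classes of (translates of) `F₁ = {0} × E`,
`F₂ = E × {0}`, `Δ`, and of the graph `Σ = Σ_A` of an endomorphism `ρ(A)`, and put `d = F₂ · Σ = |det A|`,
`f = Δ · Σ = |det(1 − A)|`.  Then the real class `L = xθ₀ + yθ₁ + zθ₂ + wθ₃` is positive (Kähler; ample when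
integral) iff `L · F₁ = y + z + w > 0`, `L · F₂ = x + z + dw > 0`, `L · Δ = x + y + fw > 0`, `L · Σ = x + dy + fz > 0`
and `L²/2 = xy + xz + xw + yz + dyw + fzw > 0` ("`L` is ample if and only if its self-intersection as well as its
intersection with the curves `F₁, F₂, Δ, Σ` are positive").  `⟹`: an ample class pairs positively with every
curve (§1) and has `L² > 0`; `⟸`: `L² > 0` and `L · (F₁ + F₂ + Δ + Σ) > 0`, the class `F₁ + F₂ + Δ + Σ` of square
`2(4 + d + f) > 0` selecting the ample nappe `Q⁺` (file 71 §1). [cite: BauerSchulz2008, §4.1 ("A line bundle `L = 𝒪_X(a₁F₁ + a₂F₂ + a₃Δ + a₄Σ)` is ample if and only if its self-intersection as well as its intersection with the curves `F₁, F₂, Δ, Σ` are positive. (This follows in the same way as indicated after (2.0.1) in the rank three case.)") and §4.2]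
[cite: KollarMori1998, §II.4 Cor. 1.21 and Example 1.23 (2)] -/
theorem pos_smul_add_graph_prodPeriodL2_self_iff (hF : finrank ℂ F = 1) (x y z w : ℝ) :
    (∀ v : WithLp 2 (F × F), v ≠ 0 → 0 < (x • θ₀ + y • θ₁ + z • θ₂ + w • θ₃) ![I • v, v]) ↔
      0 < y + z + w ∧ 0 < x + z + (A.det.natAbs : ℕ) * w ∧ 0 < x + y + ((1 - A).det.natAbs : ℕ) * w ∧
        0 < x + (A.det.natAbs : ℕ) * y + ((1 - A).det.natAbs : ℕ) * z ∧
          0 < x * y + x * z + x * w + y * z + (A.det.natAbs : ℕ) * (y * w) + ((1 - A).det.natAbs : ℕ) * (z * w) := by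
  obtain ⟨η, hη⟩ := isAbelianVariety_prodPeriodL2_self Ψ hF
  have h11 := hη.1
  have hpos := hη.2.2
  -- the NS classes
  obtain ⟨θ₀', hNS₀, -, hcl₀, -, -⟩ :=
    exists_isNSForm_re_analyticCyclePeriod_eq_intersectionForm (prodPeriodL2 Ψ Ψ) e he (Z₀.hasPureDim_carrier a₀)
  obtain ⟨θ₁', hNS₁, -, hcl₁, -, -⟩ :=
    exists_isNSForm_re_analyticCyclePeriod_eq_intersectionForm (prodPeriodL2 Ψ Ψ) e he (Z₁.hasPureDim_carrier a₁)
  obtain ⟨θ₂', hNS₂, -, hcl₂, -, -⟩ :=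
    exists_isNSForm_re_analyticCyclePeriod_eq_intersectionForm (prodPeriodL2 Ψ Ψ) e he (Z₂.hasPureDim_carrier a₂)
  obtain ⟨θ₃', hNS₃, -, hcl₃, -, -⟩ :=
    exists_isNSForm_re_analyticCyclePeriod_eq_intersectionForm (prodPeriodL2 Ψ Ψ) e he (Z₃.hasPureDim_carrier a₃)
  have e₀ : θ₀' = θ₀ := neg_injective (ofRealForm_injective (hcl₀.symm.trans hθ₀))
  have e₁ : θ₁' = θ₁ := neg_injective (ofRealForm_injective (hcl₁.symm.trans hθ₁))
  have e₂ : θ₂' = θ₂ := neg_injective (ofRealForm_injective (hcl₂.symm.trans hθ₂))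
  have e₃ : θ₃' = θ₃ := neg_injective (ofRealForm_injective (hcl₃.symm.trans hθ₃))
  subst e₀ e₁ e₂ e₃
  set S := Submodule.span ℝ {α : WithLp 2 (F × F) [⋀^Fin 2]→L[ℝ] ℝ | IsNSForm (prodPeriodL2 Ψ Ψ) α} with hS
  -- the two intersection numbers `d = |det A|`, `f = |det(1 - A)|` as opaque non-negative reals
  obtain ⟨d, hd⟩ : ∃ d : ℝ, d = ((A.det.natAbs : ℕ) : ℝ) := ⟨_, rfl⟩
  obtain ⟨f, hf⟩ : ∃ f : ℝ, f = (((1 - A).det.natAbs : ℕ) : ℝ) := ⟨_, rfl⟩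
  have hd0 : 0 ≤ d := by rw [hd]; exact Nat.cast_nonneg _
  have hf0 : 0 ≤ f := by rw [hf]; exact Nat.cast_nonneg _
  rw [← hd, ← hf]
  set L := x • θ₀' + y • θ₁' + z • θ₂' + w • θ₃' with hL
  have hLS : L ∈ S :=
    S.add_mem (S.add_mem (S.add_mem (S.smul_mem x (Submodule.subset_span hNS₀)) (S.smul_mem y (Submodule.subset_span hNS₁)))
      (S.smul_mem z (Submodule.subset_span hNS₂))) (S.smul_mem w (Submodule.subset_span hNS₃))
  have hL11 : ∀ u v, L ![I • u, I • v] = L ![u, v] := type_one_one_of_mem_span_isNSForm (prodPeriodL2 Ψ Ψ) hLS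
  -- positivity against `η` and non-vanishing of the four classes
  have p₀ := SubtorusFrame.intersectionForm_pos_of_analyticCycleClass_eq (prodPeriodL2 Ψ Ψ) e hη he Z₀ a₀ hθ₀
  have p₁ := SubtorusFrame.intersectionForm_pos_of_analyticCycleClass_eq (prodPeriodL2 Ψ Ψ) e hη he Z₁ a₁ hθ₁
  have p₂ := SubtorusFrame.intersectionForm_pos_of_analyticCycleClass_eq (prodPeriodL2 Ψ Ψ) e hη he Z₂ a₂ hθ₂
  have p₃ := SubtorusFrame.intersectionForm_pos_of_analyticCycleClass_eq (prodPeriodL2 Ψ Ψ) e hη he Z₃ a₃ hθ₃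
  have ne_of_pos : ∀ {θ : WithLp 2 (F × F) [⋀^Fin 2]→L[ℝ] ℝ}, 0 < intersectionForm (g := 2) (prodPeriodL2 Ψ Ψ) e θ η → θ ≠ 0 := by
    intro θ hθ h0
    rw [h0, map_zero, LinearMap.zero_apply] at hθ
    exact lt_irrefl _ hθ
  -- Gram data
  obtain ⟨h00, h11', h22, -, -, -⟩ :=
    intersectionForm_fibres_diagonal_prodPeriodL2_self Ψ e he Z₀ Z₁ Z₂ h₀ h₁ h₂ a₀ a₁ a₂ hθ₀ hθ₁ hθ₂
  have h33 := (intersectionForm_graph_prodPeriodL2_self Ψ e he A Z₀ Z₁ Z₂ Z₃ h₀ h₁ h₂ h₃ a₀ a₁ a₂ a₃ hθ₀ hθ₁ hθ₂ hθ₃).1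
  have hGL := intersectionForm_smul_add_graph_prodPeriodL2_self Ψ e he A Z₀ Z₁ Z₂ Z₃ h₀ h₁ h₂ h₃ a₀ a₁ a₂ a₃ hθ₀ hθ₁
    hθ₂ hθ₃ x y z w
  rw [← hL, ← hd, ← hf] at hGL
  obtain ⟨hL0, hL1, hL2, hL3, hLL⟩ := hGL
  -- the interior class `h = θ₀ + θ₁ + θ₂ + θ₃`
  set h := θ₀' + θ₁' + θ₂' + θ₃' with hh_def
  have hh1 : h = (1 : ℝ) • θ₀' + (1 : ℝ) • θ₁' + (1 : ℝ) • θ₂' + (1 : ℝ) • θ₃' := by simp only [one_smul, hh_def]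
  have hhS : h ∈ S :=
    S.add_mem (S.add_mem (S.add_mem (Submodule.subset_span hNS₀) (Submodule.subset_span hNS₁))
      (Submodule.subset_span hNS₂)) (Submodule.subset_span hNS₃)
  have hh11 : ∀ u v, h ![I • u, I • v] = h ![u, v] := type_one_one_of_mem_span_isNSForm (prodPeriodL2 Ψ Ψ) hhS
  have hGh := (intersectionForm_smul_add_graph_prodPeriodL2_self Ψ e he A Z₀ Z₁ Z₂ Z₃ h₀ h₁ h₂ h₃ a₀ a₁ a₂ a₃ hθ₀ hθ₁
    hθ₂ hθ₃ 1 1 1 1).2.2.2.2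
  rw [← hh1, ← hd, ← hf] at hGh
  simp only [mul_one] at hGh
  have hhh : 0 < intersectionForm (g := 2) (prodPeriodL2 Ψ Ψ) e h h := by
    rw [hGh]; linarith
  have hhη : 0 < intersectionForm (g := 2) (prodPeriodL2 Ψ Ψ) e h η := by
    rw [hh_def, map_add, map_add, map_add, LinearMap.add_apply, LinearMap.add_apply, LinearMap.add_apply]
    positivity
  have hLh : intersectionForm (g := 2) (prodPeriodL2 Ψ Ψ) e L h =
      (y + z + w) + (x + z + d * w) + (x + y + f * w) + (x + d * y + f * z) := by
    rw [hh_def, map_add, map_add, map_add, hL0, hL1, hL2, hL3]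
  rw [hη.pos_iff_intersectionForm_self_pos_and_pos (prodPeriodL2 Ψ Ψ) e hLS]
  constructor
  · rintro ⟨hLLpos, hLη⟩
    have q₀ := intersectionForm_pos_of_self_pos_of_self_nonneg (prodPeriodL2 Ψ Ψ) e h11 hpos hL11 hLLpos hLη
      hNS₀.type_one_one (ne_of_pos p₀) h00.ge p₀.le
    have q₁ := intersectionForm_pos_of_self_pos_of_self_nonneg (prodPeriodL2 Ψ Ψ) e h11 hpos hL11 hLLpos hLη
      hNS₁.type_one_one (ne_of_pos p₁) h11'.ge p₁.le
    have q₂ := intersectionForm_pos_of_self_pos_of_self_nonneg (prodPeriodL2 Ψ Ψ) e h11 hpos hL11 hLLpos hLη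
      hNS₂.type_one_one (ne_of_pos p₂) h22.ge p₂.le
    have q₃ := intersectionForm_pos_of_self_pos_of_self_nonneg (prodPeriodL2 Ψ Ψ) e h11 hpos hL11 hLLpos hLη
      hNS₃.type_one_one (ne_of_pos p₃) h33.ge p₃.le
    rw [hL0] at q₀
    rw [hL1] at q₁
    rw [hL2] at q₂
    rw [hL3] at q₃
    rw [hLL] at hLLpos
    exact ⟨q₀, q₁, q₂, q₃, by linarith⟩
  · rintro ⟨i₀, i₁, i₂, i₃, iq⟩
    have hLLpos : 0 < intersectionForm (g := 2) (prodPeriodL2 Ψ Ψ) e L L := by rw [hLL]; linarith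
    refine ⟨hLLpos, (intersectionForm_pos_iff_of_self_pos (prodPeriodL2 Ψ Ψ) e h11 hpos hh11 hhh hhη hL11 hLLpos).2 ?_⟩
    rw [hLh]
    linarith

include he h₀ h₁ h₂ h₃ hθ₀ hθ₁ hθ₂ hθ₃ in
/-- **… for integral coefficients: `𝒪_X(a₁F₁ + a₂F₂ + a₃Δ + a₄Σ)` is ample (`a₁θ₀ + a₂θ₁ + a₃θ₂ + a₄θ₃` is a
polarisation) iff `a₂ + a₃ + a₄ > 0`, `a₁ + a₃ + d a₄ > 0`, `a₁ + a₂ + f a₄ > 0`, `a₁ + d a₂ + f a₃ > 0`,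
`a₁a₂ + a₁a₃ + a₁a₄ + a₂a₃ + d a₂a₄ + f a₃a₄ > 0`** (`d = |det A|`, `f = |det(1 − A)|`).
[cite: BauerSchulz2008, §4.1 and §4.2 (the ample ranges of `E₁ × E₁` and `E₂ × E₂`)] -/
theorem isRiemannForm_smul_add_graph_prodPeriodL2_self_iff (hF : finrank ℂ F = 1) (a b c d' : ℤ) :
    IsRiemannForm (prodPeriodL2 Ψ Ψ) (a • θ₀ + b • θ₁ + c • θ₂ + d' • θ₃) ↔
      0 < b + c + d' ∧ 0 < a + c + (A.det.natAbs : ℕ) * d' ∧ 0 < a + b + ((1 - A).det.natAbs : ℕ) * d' ∧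
        0 < a + (A.det.natAbs : ℕ) * b + ((1 - A).det.natAbs : ℕ) * c ∧
          0 < a * b + a * c + a * d' + b * c + (A.det.natAbs : ℕ) * (b * d') + ((1 - A).det.natAbs : ℕ) * (c * d') := by
  obtain ⟨θ₀', hNS₀, -, hcl₀, -, -⟩ :=
    exists_isNSForm_re_analyticCyclePeriod_eq_intersectionForm (prodPeriodL2 Ψ Ψ) e he (Z₀.hasPureDim_carrier a₀)
  obtain ⟨θ₁', hNS₁, -, hcl₁, -, -⟩ :=
    exists_isNSForm_re_analyticCyclePeriod_eq_intersectionForm (prodPeriodL2 Ψ Ψ) e he (Z₁.hasPureDim_carrier a₁)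
  obtain ⟨θ₂', hNS₂, -, hcl₂, -, -⟩ :=
    exists_isNSForm_re_analyticCyclePeriod_eq_intersectionForm (prodPeriodL2 Ψ Ψ) e he (Z₂.hasPureDim_carrier a₂)
  obtain ⟨θ₃', hNS₃, -, hcl₃, -, -⟩ :=
    exists_isNSForm_re_analyticCyclePeriod_eq_intersectionForm (prodPeriodL2 Ψ Ψ) e he (Z₃.hasPureDim_carrier a₃)
  have e₀ : θ₀' = θ₀ := neg_injective (ofRealForm_injective (hcl₀.symm.trans hθ₀))
  have e₁ : θ₁' = θ₁ := neg_injective (ofRealForm_injective (hcl₁.symm.trans hθ₁))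
  have e₂ : θ₂' = θ₂ := neg_injective (ofRealForm_injective (hcl₂.symm.trans hθ₂))
  have e₃ : θ₃' = θ₃ := neg_injective (ofRealForm_injective (hcl₃.symm.trans hθ₃))
  subst e₀ e₁ e₂ e₃
  have hNS : IsNSForm (prodPeriodL2 Ψ Ψ) (a • θ₀' + b • θ₁' + c • θ₂' + d' • θ₃') := by
    have hm : a • θ₀' + b • θ₁' + c • θ₂' + d' • θ₃' ∈ neronSeveriGroup (prodPeriodL2 Ψ Ψ) :=
      (neronSeveriGroup (prodPeriodL2 Ψ Ψ)).add_mem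
        ((neronSeveriGroup (prodPeriodL2 Ψ Ψ)).add_mem
          ((neronSeveriGroup (prodPeriodL2 Ψ Ψ)).add_mem ((neronSeveriGroup (prodPeriodL2 Ψ Ψ)).zsmul_mem hNS₀ a)
            ((neronSeveriGroup (prodPeriodL2 Ψ Ψ)).zsmul_mem hNS₁ b))
          ((neronSeveriGroup (prodPeriodL2 Ψ Ψ)).zsmul_mem hNS₂ c))
        ((neronSeveriGroup (prodPeriodL2 Ψ Ψ)).zsmul_mem hNS₃ d')
    exact hm
  have hreal : a • θ₀' + b • θ₁' + c • θ₂' + d' • θ₃' = (a : ℝ) • θ₀' + (b : ℝ) • θ₁' + (c : ℝ) • θ₂' + (d' : ℝ) • θ₃' := by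
    simp only [Int.cast_smul_eq_zsmul]
  have key := pos_smul_add_graph_prodPeriodL2_self_iff Ψ e he A Z₀ Z₁ Z₂ Z₃ h₀ h₁ h₂ h₃ a₀ a₁ a₂ a₃ hθ₀ hθ₁ hθ₂ hθ₃ hF
    (a : ℝ) b c d'
  -- read the two intersection numbers as opaque integers `dI`, `fI`
  obtain ⟨dI, hdI⟩ : ∃ dI : ℤ, dI = ((A.det.natAbs : ℕ) : ℤ) := ⟨_, rfl⟩
  obtain ⟨fI, hfI⟩ : ∃ fI : ℤ, fI = (((1 - A).det.natAbs : ℕ) : ℤ) := ⟨_, rfl⟩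
  have hdR : ((A.det.natAbs : ℕ) : ℝ) = ((dI : ℤ) : ℝ) := by rw [hdI, Int.cast_natCast]
  have hfR : (((1 - A).det.natAbs : ℕ) : ℝ) = ((fI : ℤ) : ℝ) := by rw [hfI, Int.cast_natCast]
  rw [hdR, hfR] at key
  rw [← hdI, ← hfI]
  constructor
  · intro h
    have hp := h.2.2
    rw [hreal] at hp
    obtain ⟨i₀, i₁, i₂, i₃, iq⟩ := key.1 hp
    exact ⟨by exact_mod_cast i₀, by exact_mod_cast i₁, by exact_mod_cast i₂, by exact_mod_cast i₃, by exact_mod_cast iq⟩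
  · rintro ⟨i₀, i₁, i₂, i₃, iq⟩
    refine ⟨hNS.type_one_one, hNS.integral, ?_⟩
    rw [hreal]
    exact key.2 ⟨by exact_mod_cast i₀, by exact_mod_cast i₁, by exact_mod_cast i₂, by exact_mod_cast i₃, by exact_mod_cast iq⟩

include he h₀ h₁ h₂ h₃ hθ₀ hθ₁ hθ₂ hθ₃ in
/-- **`F₁, F₂, Δ, Σ` are linearly independent in `NS_ℝ(E × E)`** as soon as the linear system
`L · F₁ = L · F₂ = L · Δ = L · Σ = 0` (coefficients `1, d = |det A|, f = |det(1 − A)|`) has only the trivial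
solution — e.g. for `(d, f) = (1, 2)` (`α = i`) or `(1, 1)` (`α = e^{πi/3}`); for `Σ = Γ_n` (`d = n²`, `f = (n−1)²`)
the Gram determinant `(d − f)² − 2(d + f) + 1` vanishes and the four classes are dependent.
[cite: BauerSchulz2008, §4.1 ("The Néron–Severi group of `E₁ × E₁` is of rank four, with generators `F₁, F₂, Δ, Σ`") and §4.2] -/
theorem linearIndependent_fibres_diagonal_graph_prodPeriodL2_self
    (hsol : ∀ x y z w : ℝ, y + z + w = 0 → x + z + (A.det.natAbs : ℕ) * w = 0 →
      x + y + ((1 - A).det.natAbs : ℕ) * w = 0 → x + (A.det.natAbs : ℕ) * y + ((1 - A).det.natAbs : ℕ) * z = 0 →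
        x = 0 ∧ y = 0 ∧ z = 0 ∧ w = 0) :
    LinearIndependent ℝ ![θ₀, θ₁, θ₂, θ₃] := by
  rw [Fintype.linearIndependent_iff]
  intro c hc
  have hsum : ∑ i, c i • ![θ₀, θ₁, θ₂, θ₃] i = c 0 • θ₀ + c 1 • θ₁ + c 2 • θ₂ + c 3 • θ₃ := by
    simp [Fin.sum_univ_four]
  rw [hsum] at hc
  have hG := intersectionForm_smul_add_graph_prodPeriodL2_self Ψ e he A Z₀ Z₁ Z₂ Z₃ h₀ h₁ h₂ h₃ a₀ a₁ a₂ a₃ hθ₀ hθ₁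
    hθ₂ hθ₃ (c 0) (c 1) (c 2) (c 3)
  rw [hc] at hG
  simp only [map_zero, LinearMap.zero_apply] at hG
  obtain ⟨e0, e1, e2, e3, -⟩ := hG
  obtain ⟨c0, c1, c2, c3⟩ := hsol (c 0) (c 1) (c 2) (c 3) e0.symm e1.symm e2.symm e3.symm
  intro i
  fin_cases i
  · exact c0
  · exact c1
  · exact c2
  · exact c3

include he h₀ h₁ h₂ h₃ hθ₀ hθ₁ hθ₂ hθ₃ in
/-- **… and then they span `NS_ℝ(E × E)` when `E` has complex multiplication** (`ρ(E × E) = 4`, file 70): the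
classes of `F₁, F₂, Δ, Σ` generate the real Néron–Severi group. [cite: BauerSchulz2008, §4.1 ("The Néron–Severi group of `E₁ × E₁` is of rank four, with generators `F₁, F₂, Δ, Σ`") and §4.2 ("`F₁, F₂`, the diagonal `Δ`, and the graph `Σ` of `σ` generate the Néron–Severi group of `X`")] -/
theorem span_fibres_diagonal_graph_prodPeriodL2_self_eq (hF : finrank ℂ F = 1) (hE : endAlgRat Ψ ≠ ⊥)
    (hsol : ∀ x y z w : ℝ, y + z + w = 0 → x + z + (A.det.natAbs : ℕ) * w = 0 →
      x + y + ((1 - A).det.natAbs : ℕ) * w = 0 → x + (A.det.natAbs : ℕ) * y + ((1 - A).det.natAbs : ℕ) * z = 0 →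
        x = 0 ∧ y = 0 ∧ z = 0 ∧ w = 0) :
    Submodule.span ℝ (Set.range ![θ₀, θ₁, θ₂, θ₃]) =
      Submodule.span ℝ {α : WithLp 2 (F × F) [⋀^Fin 2]→L[ℝ] ℝ | IsNSForm (prodPeriodL2 Ψ Ψ) α} := by
  classical
  have hind := linearIndependent_fibres_diagonal_graph_prodPeriodL2_self Ψ e he A Z₀ Z₁ Z₂ Z₃ h₀ h₁ h₂ h₃ a₀ a₁ a₂ a₃
    hθ₀ hθ₁ hθ₂ hθ₃ hsol
  obtain ⟨θ₀', hNS₀, -, hcl₀, -, -⟩ :=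
    exists_isNSForm_re_analyticCyclePeriod_eq_intersectionForm (prodPeriodL2 Ψ Ψ) e he (Z₀.hasPureDim_carrier a₀)
  obtain ⟨θ₁', hNS₁, -, hcl₁, -, -⟩ :=
    exists_isNSForm_re_analyticCyclePeriod_eq_intersectionForm (prodPeriodL2 Ψ Ψ) e he (Z₁.hasPureDim_carrier a₁)
  obtain ⟨θ₂', hNS₂, -, hcl₂, -, -⟩ :=
    exists_isNSForm_re_analyticCyclePeriod_eq_intersectionForm (prodPeriodL2 Ψ Ψ) e he (Z₂.hasPureDim_carrier a₂)
  obtain ⟨θ₃', hNS₃, -, hcl₃, -, -⟩ :=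
    exists_isNSForm_re_analyticCyclePeriod_eq_intersectionForm (prodPeriodL2 Ψ Ψ) e he (Z₃.hasPureDim_carrier a₃)
  have e₀ : θ₀' = θ₀ := neg_injective (ofRealForm_injective (hcl₀.symm.trans hθ₀))
  have e₁ : θ₁' = θ₁ := neg_injective (ofRealForm_injective (hcl₁.symm.trans hθ₁))
  have e₂ : θ₂' = θ₂ := neg_injective (ofRealForm_injective (hcl₂.symm.trans hθ₂))
  have e₃ : θ₃' = θ₃ := neg_injective (ofRealForm_injective (hcl₃.symm.trans hθ₃))
  subst e₀ e₁ e₂ e₃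
  set S := Submodule.span ℝ {α : WithLp 2 (F × F) [⋀^Fin 2]→L[ℝ] ℝ | IsNSForm (prodPeriodL2 Ψ Ψ) α} with hS
  haveI : FiniteDimensional ℝ S := by
    haveI := finiteDimensional_realForms (g := 2) (prodPeriodL2 Ψ Ψ) e (k := 2) (by omega)
    infer_instance
  have hle : Submodule.span ℝ (Set.range ![θ₀', θ₁', θ₂', θ₃']) ≤ S := by
    rw [Submodule.span_le]
    rintro _ ⟨i, rfl⟩
    fin_cases i
    · exact Submodule.subset_span hNS₀
    · exact Submodule.subset_span hNS₁
    · exact Submodule.subset_span hNS₂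
    · exact Submodule.subset_span hNS₃
  have h4 : finrank ℝ (Submodule.span ℝ (Set.range ![θ₀', θ₁', θ₂', θ₃'])) = 4 := by
    rw [finrank_span_eq_card hind]
    simp
  have hS4 : finrank ℝ S = 4 := by
    rw [hS, finrank_span_isNSForm_eq_finrank_neronSeveriGroup,
      finrank_neronSeveriGroup_prodPeriodL2_self_of_endAlgRat_ne_bot Ψ hF hE]
  exact Submodule.eq_of_le_of_finrank_le hle (hS4.trans h4.symm).le

end FourGenerators

/-! ### §3 `E_τ × E_τ`: `F₂ · Σ_α = |α|²`, `Δ · Σ_α = |1 − α|²`, and Bauer–Schulz's ample ranges for `α = i`,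
`α = e^{πi/3}` -/

section Elliptic

variable {τ : ℂ} (hτ : τ.im ≠ 0)

/-- **The graph `Σ_α` of the endomorphism `[x] ↦ [αx]` of `E_τ` (`α = ρ_a(A) ∈ ℛ`) is an elliptic curve through `0`
of `E_τ × E_τ`** (the Euclidean graph datum of `ρ(A)`, whose analytic representation is `α · 1_ℂ`).
[cite: BauerSchulz2008, §4.1 ("`Σ` is the graph of the automorphism `ι : E₁ → E₁, [x] ↦ [ix]`")] [cite: Lange2023AbelianVarietiesComplex, §6.2.2 (p. 304)] -/
theorem exists_subtorusFrame_carrier_eq_setOf_graph_ellipticPeriod {A : Matrix (Fin 2) (Fin 2) ℤ}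
    (hA : A ∈ endRingInt (ellipticPeriod hτ)) :
    ∃ Z : SubtorusFrame (prodPeriodL2 (ellipticPeriod hτ) (ellipticPeriod hτ)) (2 * 1),
      Z.carrier 0 = {t | (prodHomeomorphL2 (ellipticPeriod hτ) (ellipticPeriod hτ) t).2 =
        mapMatrix (ellipticPeriod hτ) (ellipticPeriod hτ) A (prodHomeomorphL2 (ellipticPeriod hτ) (ellipticPeriod hτ) t).1} := by
  obtain ⟨e₁, he₁⟩ := exists_orientationSign_eq_one (ellipticPeriod hτ) (Equiv.refl (Fin (2 * 1)))
  have hA' := exists_eq_mul_of_mem_endRingInt hτ hA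
  exact exists_subtorusFrame_carrier_eq_setOf_graph (ellipticPeriod hτ) e₁ he₁
    (L := (((A 0 1 : ℂ) * τ + A 1 1) • ContinuousLinearMap.id ℂ ℂ)) fun x ↦ by rw [hA']; rfl

/-- `|det A| = |α|²` and `|det(1 − A)| = |1 − α|²` for `A ∈ End(E_τ)` with analytic representation `α`.
[cite: Hartshorne1977, Ch. IV Exercise 4.11 (a) (`deg [α] = |α|²`)] -/
theorem natAbs_det_eq_normSq_and {A : Matrix (Fin 2) (Fin 2) ℤ} (hA : A ∈ endRingInt (ellipticPeriod hτ)) :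
    ((A.det.natAbs : ℕ) : ℝ) = Complex.normSq ((ellipticEndEquiv hτ ⟨A, hA⟩ : ellipticEnd hτ) : ℂ) ∧
      (((1 - A).det.natAbs : ℕ) : ℝ) = Complex.normSq (1 - ((ellipticEndEquiv hτ ⟨A, hA⟩ : ellipticEnd hτ) : ℂ)) := by
  have h1A : 1 - A ∈ endRingInt (ellipticPeriod hτ) := Subring.sub_mem _ (Subring.one_mem _) hA
  have h := natCard_ker_eq_normSq hτ hA
  have h' := natCard_ker_eq_normSq hτ h1A
  rw [natCard_ker_mapMatrixHom] at h h'
  refine ⟨h, ?_⟩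
  rw [h']
  have hsub : (⟨1 - A, h1A⟩ : endRingInt (ellipticPeriod hτ)) = 1 - ⟨A, hA⟩ := rfl
  rw [hsub, map_sub, map_one]
  rfl

variable (e : Fin (2 * 2) ≃ Fin 2 ⊕ Fin 2)
  (he : orientationSign (prodPeriodL2 (ellipticPeriod hτ) (ellipticPeriod hτ)) e = 1) {A : Matrix (Fin 2) (Fin 2) ℤ}
  (hA : A ∈ endRingInt (ellipticPeriod hτ))
  (Z₀ Z₁ Z₂ Z₃ : SubtorusFrame (prodPeriodL2 (ellipticPeriod hτ) (ellipticPeriod hτ)) (2 * 1))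
  (h₀ : Z₀.carrier 0 = {t | (prodHomeomorphL2 (ellipticPeriod hτ) (ellipticPeriod hτ) t).1 = 0})
  (h₁ : Z₁.carrier 0 = {t | (prodHomeomorphL2 (ellipticPeriod hτ) (ellipticPeriod hτ) t).2 = 0})
  (h₂ : Z₂.carrier 0 = {t | (prodHomeomorphL2 (ellipticPeriod hτ) (ellipticPeriod hτ) t).2 =
    (prodHomeomorphL2 (ellipticPeriod hτ) (ellipticPeriod hτ) t).1})
  (h₃ : Z₃.carrier 0 = {t | (prodHomeomorphL2 (ellipticPeriod hτ) (ellipticPeriod hτ) t).2 =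
    mapMatrix (ellipticPeriod hτ) (ellipticPeriod hτ) A (prodHomeomorphL2 (ellipticPeriod hτ) (ellipticPeriod hτ) t).1})
  (a₀ a₁ a₂ a₃ : WithLp 2 (ℂ × ℂ)) {θ₀ θ₁ θ₂ θ₃ : WithLp 2 (ℂ × ℂ) [⋀^Fin 2]→L[ℝ] ℝ}
  (hθ₀ : analyticCycleClass (prodPeriodL2 (ellipticPeriod hτ) (ellipticPeriod hτ)) e (show 2 * 1 + 2 * 1 = 2 * 2 from rfl)
    (Z₀.hasPureDim_carrier a₀) = ofRealForm (-θ₀))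
  (hθ₁ : analyticCycleClass (prodPeriodL2 (ellipticPeriod hτ) (ellipticPeriod hτ)) e (show 2 * 1 + 2 * 1 = 2 * 2 from rfl)
    (Z₁.hasPureDim_carrier a₁) = ofRealForm (-θ₁))
  (hθ₂ : analyticCycleClass (prodPeriodL2 (ellipticPeriod hτ) (ellipticPeriod hτ)) e (show 2 * 1 + 2 * 1 = 2 * 2 from rfl)
    (Z₂.hasPureDim_carrier a₂) = ofRealForm (-θ₂))
  (hθ₃ : analyticCycleClass (prodPeriodL2 (ellipticPeriod hτ) (ellipticPeriod hτ)) e (show 2 * 1 + 2 * 1 = 2 * 2 from rfl)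
    (Z₃.hasPureDim_carrier a₃) = ofRealForm (-θ₃))

include he hA h₀ h₁ h₂ h₃ hθ₀ hθ₁ hθ₂ hθ₃ in
/-- **The ample range of `E_τ × E_τ` in the generators `F₁, F₂, Δ, Σ_α`**: with `α = ρ_a(A) ∈ End(E_τ)`,
`L = xθ₀ + yθ₁ + zθ₂ + wθ₃` is positive iff `y + z + w > 0`, `x + z + |α|²w > 0`, `x + y + |1−α|²w > 0`,
`x + |α|²y + |1−α|²z > 0`, `xy + xz + xw + yz + |α|²yw + |1−α|²zw > 0`. [cite: BauerSchulz2008, §4.1 and §4.2]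
[cite: Hartshorne1977, Ch. IV Exercise 4.11 (a)] -/
theorem pos_smul_add_graph_ellipticPeriod_iff (x y z w : ℝ) :
    (∀ v : WithLp 2 (ℂ × ℂ), v ≠ 0 → 0 < (x • θ₀ + y • θ₁ + z • θ₂ + w • θ₃) ![I • v, v]) ↔
      0 < y + z + w ∧ 0 < x + z + Complex.normSq ((ellipticEndEquiv hτ ⟨A, hA⟩ : ellipticEnd hτ) : ℂ) * w ∧
        0 < x + y + Complex.normSq (1 - ((ellipticEndEquiv hτ ⟨A, hA⟩ : ellipticEnd hτ) : ℂ)) * w ∧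
        0 < x + Complex.normSq ((ellipticEndEquiv hτ ⟨A, hA⟩ : ellipticEnd hτ) : ℂ) * y +
          Complex.normSq (1 - ((ellipticEndEquiv hτ ⟨A, hA⟩ : ellipticEnd hτ) : ℂ)) * z ∧
        0 < x * y + x * z + x * w + y * z + Complex.normSq ((ellipticEndEquiv hτ ⟨A, hA⟩ : ellipticEnd hτ) : ℂ) * (y * w) +
          Complex.normSq (1 - ((ellipticEndEquiv hτ ⟨A, hA⟩ : ellipticEnd hτ) : ℂ)) * (z * w) := by
  obtain ⟨hd, hf⟩ := natAbs_det_eq_normSq_and hτ hA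
  rw [← hd, ← hf]
  exact pos_smul_add_graph_prodPeriodL2_self_iff (ellipticPeriod hτ) e he A Z₀ Z₁ Z₂ Z₃ h₀ h₁ h₂ h₃ a₀ a₁ a₂ a₃
    hθ₀ hθ₁ hθ₂ hθ₃ (Module.finrank_self ℂ) x y z w

include he hA h₀ h₁ h₂ h₃ hθ₀ hθ₁ hθ₂ hθ₃ in
/-- **BAUER–SCHULZ §4.1 VERBATIM (`E₁ = ℂ/(ℤ + iℤ)`, `Σ` the graph of `[x] ↦ [ix]`)**: `L = a₁F₁ + a₂F₂ + a₃Δ + a₄Σ`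
(real coefficients `x, y, z, w`) is positive iff `a₂ + a₃ + a₄ > 0`, `a₁ + a₃ + a₄ > 0`, `a₁ + a₂ + 2a₄ > 0`,
`a₁ + a₂ + 2a₃ > 0`, `a₁a₂ + a₁a₃ + a₁a₄ + a₂a₃ + a₂a₄ + 2a₃a₄ > 0` (`|i|² = 1`, `|1 − i|² = 2`).
[cite: BauerSchulz2008, §4.1 ("So `L` is ample if and only if `a₂ + a₃ + a₄ > 0, a₁ + a₃ + a₄ > 0, a₁ + a₂ + 2a₄ > 0, a₂ + a₂ + 2a₃ > 0, a₁a₂ + a₁a₃ + a₁a₄ + a₂a₃ + a₂a₄ + 2a₃a₄ > 0`")] -/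
theorem pos_smul_add_graph_ellipticPeriod_iff_of_eq_I (hi : ((ellipticEndEquiv hτ ⟨A, hA⟩ : ellipticEnd hτ) : ℂ) = I)
    (x y z w : ℝ) :
    (∀ v : WithLp 2 (ℂ × ℂ), v ≠ 0 → 0 < (x • θ₀ + y • θ₁ + z • θ₂ + w • θ₃) ![I • v, v]) ↔
      0 < y + z + w ∧ 0 < x + z + w ∧ 0 < x + y + 2 * w ∧ 0 < x + y + 2 * z ∧
        0 < x * y + x * z + x * w + y * z + y * w + 2 * (z * w) := by
  have h2 : Complex.normSq (1 - I) = 2 := by simp [Complex.normSq_apply]; norm_num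
  rw [pos_smul_add_graph_ellipticPeriod_iff hτ e he hA Z₀ Z₁ Z₂ Z₃ h₀ h₁ h₂ h₃ a₀ a₁ a₂ a₃ hθ₀ hθ₁ hθ₂ hθ₃, hi,
    Complex.normSq_I, h2]
  simp only [one_mul]

include he hA h₀ h₁ h₂ h₃ hθ₀ hθ₁ hθ₂ hθ₃ in
/-- **BAUER–SCHULZ §4.2 VERBATIM (`E₂ = ℂ/(ℤ + e^{πi/3}ℤ)`, `Σ` the graph of `σ : [x] ↦ [e^{πi/3}x]`)**: `L` is positive
iff `a₂ + a₃ + a₄ = L · F₁ > 0`, `a₁ + a₃ + a₄ = L · F₂ > 0`, `a₁ + a₂ + a₄ = L · Δ > 0`, `a₁ + a₂ + a₃ = L · Σ > 0`,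
`a₁a₂ + a₁a₃ + a₁a₄ + a₂a₃ + a₂a₄ + a₃a₄ = L²/2 > 0` (`|e^{πi/3}|² = |1 − e^{πi/3}|² = 1`).
[cite: BauerSchulz2008, §4.2 ("A line bundle `L = 𝒪_X(a₁F₁ + a₂F₂ + a₃Δ + a₄Σ)` is ample if and only if `a₂ + a₃ + a₄ = L · F₁ > 0, a₁ + a₃ + a₄ = L · F₂ > 0, a₁ + a₂ + a₄ = L · Δ > 0, a₁ + a₂ + a₃ = L · Σ > 0, 2(a₁a₂ + a₁a₃ + a₁a₄ + a₂a₃ + a₂a₄ + a₃a₄) = L² > 0`")] -/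
theorem pos_smul_add_graph_ellipticPeriod_iff_of_eq_exp
    (hσ : ((ellipticEndEquiv hτ ⟨A, hA⟩ : ellipticEnd hτ) : ℂ) = Complex.exp (↑(Real.pi / 3) * I)) (x y z w : ℝ) :
    (∀ v : WithLp 2 (ℂ × ℂ), v ≠ 0 → 0 < (x • θ₀ + y • θ₁ + z • θ₂ + w • θ₃) ![I • v, v]) ↔
      0 < y + z + w ∧ 0 < x + z + w ∧ 0 < x + y + w ∧ 0 < x + y + z ∧
        0 < x * y + x * z + x * w + y * z + y * w + z * w := by
  have hcos : (Complex.exp (↑(Real.pi / 3) * I)).re = 1 / 2 := by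
    rw [Complex.exp_ofReal_mul_I_re, Real.cos_pi_div_three]
  have hsin : (Complex.exp (↑(Real.pi / 3) * I)).im = Real.sqrt 3 / 2 := by
    rw [Complex.exp_ofReal_mul_I_im, Real.sin_pi_div_three]
  have h3 : Real.sqrt 3 * Real.sqrt 3 = 3 := Real.mul_self_sqrt (by norm_num)
  have hn1 : Complex.normSq (Complex.exp (↑(Real.pi / 3) * I)) = 1 := by
    rw [Complex.normSq_apply, hcos, hsin]
    nlinarith [h3]
  have hn2 : Complex.normSq (1 - Complex.exp (↑(Real.pi / 3) * I)) = 1 := by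
    rw [Complex.normSq_apply, Complex.sub_re, Complex.sub_im, Complex.one_re, Complex.one_im, hcos, hsin]
    nlinarith [h3]
  rw [pos_smul_add_graph_ellipticPeriod_iff hτ e he hA Z₀ Z₁ Z₂ Z₃ h₀ h₁ h₂ h₃ a₀ a₁ a₂ a₃ hθ₀ hθ₁ hθ₂ hθ₃, hσ, hn1, hn2]
  simp only [one_mul]

include hA in
/-- An `E_τ` with an endomorphism of analytic representation `α ∉ ℤ` (e.g. `α = i`) has complex multiplication:
`End_ℚ(E_τ) ≠ ℚ`. [cite: SilvermanAEC2009, Ch. VI Thm. 5.5] -/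
theorem endAlgRat_ellipticPeriod_ne_bot_of_im_ne_zero
    (hα : (((ellipticEndEquiv hτ ⟨A, hA⟩ : ellipticEnd hτ) : ℂ)).im ≠ 0) : endAlgRat (ellipticPeriod hτ) ≠ ⊥ := by
  rw [Ne, endAlgRat_ellipticPeriod_eq_bot_iff]
  intro hbot
  have hmem : ((ellipticEndEquiv hτ ⟨A, hA⟩ : ellipticEnd hτ) : ℂ) ∈ (⊥ : Subring ℂ) :=
    hbot.le (ellipticEndEquiv hτ ⟨A, hA⟩).2
  obtain ⟨n, hn⟩ := Subring.mem_bot.1 hmem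
  apply hα
  rw [← hn]
  exact Complex.intCast_im n

include he hA h₀ h₁ h₂ h₃ hθ₀ hθ₁ hθ₂ hθ₃ in
/-- **BAUER–SCHULZ §4.1: "The Néron–Severi group of `E₁ × E₁` is of rank four, with generators `F₁, F₂, Δ, Σ`"** —
for `α = i` the classes of `F₁, F₂, Δ, Σ` form a basis of `NS_ℝ(E_τ × E_τ)` (linearly independent, spanning the
real Néron–Severi group, which has rank `4`). [cite: BauerSchulz2008, §4.1] -/
theorem linearIndependent_and_span_eq_of_eq_I (hi : ((ellipticEndEquiv hτ ⟨A, hA⟩ : ellipticEnd hτ) : ℂ) = I) :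
    LinearIndependent ℝ ![θ₀, θ₁, θ₂, θ₃] ∧
      Submodule.span ℝ (Set.range ![θ₀, θ₁, θ₂, θ₃]) =
        Submodule.span ℝ {α : WithLp 2 (ℂ × ℂ) [⋀^Fin 2]→L[ℝ] ℝ |
          IsNSForm (prodPeriodL2 (ellipticPeriod hτ) (ellipticPeriod hτ)) α} := by
  obtain ⟨hd, hf⟩ := natAbs_det_eq_normSq_and hτ hA
  have h2 : Complex.normSq (1 - I) = 2 := by simp [Complex.normSq_apply]; norm_num
  rw [hi, Complex.normSq_I] at hd
  rw [hi, h2] at hf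
  have hsol : ∀ x y z w : ℝ, y + z + w = 0 → x + z + (A.det.natAbs : ℕ) * w = 0 →
      x + y + ((1 - A).det.natAbs : ℕ) * w = 0 → x + (A.det.natAbs : ℕ) * y + ((1 - A).det.natAbs : ℕ) * z = 0 →
        x = 0 ∧ y = 0 ∧ z = 0 ∧ w = 0 := by
    rw [hd, hf]
    intro x y z w e1 e2 e3 e4
    refine ⟨by linarith, by linarith, by linarith, by linarith⟩
  have hE : endAlgRat (ellipticPeriod hτ) ≠ ⊥ :=
    endAlgRat_ellipticPeriod_ne_bot_of_im_ne_zero hτ hA (by rw [hi, Complex.I_im]; exact one_ne_zero)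
  exact ⟨linearIndependent_fibres_diagonal_graph_prodPeriodL2_self (ellipticPeriod hτ) e he A Z₀ Z₁ Z₂ Z₃ h₀ h₁ h₂ h₃
      a₀ a₁ a₂ a₃ hθ₀ hθ₁ hθ₂ hθ₃ hsol,
    span_fibres_diagonal_graph_prodPeriodL2_self_eq (ellipticPeriod hτ) e he A Z₀ Z₁ Z₂ Z₃ h₀ h₁ h₂ h₃ a₀ a₁ a₂ a₃
      hθ₀ hθ₁ hθ₂ hθ₃ (Module.finrank_self ℂ) hE hsol⟩

include he hA h₀ h₁ h₂ h₃ hθ₀ hθ₁ hθ₂ hθ₃ in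
/-- **BAUER–SCHULZ §4.2: "`F₁, F₂`, the diagonal `Δ`, and the graph `Σ` of `σ` generate the Néron–Severi group"** —
for `α = e^{πi/3}` the classes of `F₁, F₂, Δ, Σ` form a basis of `NS_ℝ(E_τ × E_τ)`. [cite: BauerSchulz2008, §4.2] -/
theorem linearIndependent_and_span_eq_of_eq_exp
    (hσ : ((ellipticEndEquiv hτ ⟨A, hA⟩ : ellipticEnd hτ) : ℂ) = Complex.exp (↑(Real.pi / 3) * I)) :
    LinearIndependent ℝ ![θ₀, θ₁, θ₂, θ₃] ∧
      Submodule.span ℝ (Set.range ![θ₀, θ₁, θ₂, θ₃]) =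
        Submodule.span ℝ {α : WithLp 2 (ℂ × ℂ) [⋀^Fin 2]→L[ℝ] ℝ |
          IsNSForm (prodPeriodL2 (ellipticPeriod hτ) (ellipticPeriod hτ)) α} := by
  have hcos : (Complex.exp (↑(Real.pi / 3) * I)).re = 1 / 2 := by
    rw [Complex.exp_ofReal_mul_I_re, Real.cos_pi_div_three]
  have hsin : (Complex.exp (↑(Real.pi / 3) * I)).im = Real.sqrt 3 / 2 := by
    rw [Complex.exp_ofReal_mul_I_im, Real.sin_pi_div_three]
  have h3 : Real.sqrt 3 * Real.sqrt 3 = 3 := Real.mul_self_sqrt (by norm_num)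
  have hn1 : Complex.normSq (Complex.exp (↑(Real.pi / 3) * I)) = 1 := by
    rw [Complex.normSq_apply, hcos, hsin]
    nlinarith [h3]
  have hn2 : Complex.normSq (1 - Complex.exp (↑(Real.pi / 3) * I)) = 1 := by
    rw [Complex.normSq_apply, Complex.sub_re, Complex.sub_im, Complex.one_re, Complex.one_im, hcos, hsin]
    nlinarith [h3]
  obtain ⟨hd, hf⟩ := natAbs_det_eq_normSq_and hτ hA
  rw [hσ, hn1] at hd
  rw [hσ, hn2] at hf
  have hsol : ∀ x y z w : ℝ, y + z + w = 0 → x + z + (A.det.natAbs : ℕ) * w = 0 →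
      x + y + ((1 - A).det.natAbs : ℕ) * w = 0 → x + (A.det.natAbs : ℕ) * y + ((1 - A).det.natAbs : ℕ) * z = 0 →
        x = 0 ∧ y = 0 ∧ z = 0 ∧ w = 0 := by
    rw [hd, hf]
    intro x y z w e1 e2 e3 e4
    refine ⟨by linarith, by linarith, by linarith, by linarith⟩
  have hE : endAlgRat (ellipticPeriod hτ) ≠ ⊥ :=
    endAlgRat_ellipticPeriod_ne_bot_of_im_ne_zero hτ hA (by
      rw [hσ, hsin]
      have : 0 < Real.sqrt 3 := Real.sqrt_pos.2 (by norm_num)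
      positivity)
  exact ⟨linearIndependent_fibres_diagonal_graph_prodPeriodL2_self (ellipticPeriod hτ) e he A Z₀ Z₁ Z₂ Z₃ h₀ h₁ h₂ h₃
      a₀ a₁ a₂ a₃ hθ₀ hθ₁ hθ₂ hθ₃ hsol,
    span_fibres_diagonal_graph_prodPeriodL2_self_eq (ellipticPeriod hτ) e he A Z₀ Z₁ Z₂ Z₃ h₀ h₁ h₂ h₃ a₀ a₁ a₂ a₃
      hθ₀ hθ₁ hθ₂ hθ₃ (Module.finrank_self ℂ) hE hsol⟩

end Elliptic

end ComplexTorus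

end Literature.Geometry.Kaehler
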